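import Summits.HubbardSuperconductivity.HubbardSuperconductivity.Theses.AnisotropyChord
import Summits.HubbardSuperconductivity.HubbardSuperconductivity.Theorems.AnisotropyChordThermalCondensateDefs

/-!
# Route `AnisotropyChord`, crux `ChordXY` (stmt-HubbardSuperconductivity-8146): the crux follows from the ONE
# remaining registered stub `stub_thermalChordAF` (the thermal chord) — skeleton composition as a tree theorem

The `ChordXY` birth skeleton (sha `c9438cf6…`; = line `thermal_af` of the parent crux `ChordFM`) composes
`ChordXY` from two stubs: the THERMAL CHORD `stub_thermalChordAF`
(`∀ even M ≥ 4, Δ ∈ [-1,0]: ∀ᶠ β, (1+Δ)·Λ_{β,M}(0) ≤ Λ_{β,M}(Δ)`, `Λ_{β,M} = thermalCondensate`, the canonical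
`S^z_tot = 0` sector condensate — the open engine statement) and the ground-state limit `stub_groundStateLimit`,
which is now the tree theorem `…Theorems.AnisotropyChord.stub_groundStateLimit` (`…ThermalCondensateDefs`).
Hence:

* `chordXY_of_thermalChordAF` — **`stub_thermalChordAF → ChordXY`** (the route decl BY NAME): both sides of the
  thermal chord converge as `β → ∞` (`stub_groundStateLimit` at `Δ = 0` for `ψ₀` and at `Δ` for `ψ`) and `≤`
  passes to the limit (`le_of_tendsto_of_tendsto`).

So the crux `ChordXY` is reduced, in the tree, to the single thermal inequality. Nothing here claims the thermal
chord; `ChordXY` is NOT proved. Sources: the skeleton (`Cruxes/ChordFM/Lines/thermal_af.lean`, composition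
`chordXY_of_thermal`); O. Bratteli, D. W. Robinson, *Operator Algebras and Quantum Statistical Mechanics II*
§5.3.1. No definition is introduced.
-/

set_option linter.dupNamespace false

noncomputable section

namespace Summit.HubbardSuperconductivity.HubbardSuperconductivity.Theorems.AnisotropyChord

open Matrix Filter Topology
open Literature.MathematicalPhysics.QuantumLattice Literature.Probability.LatticeModels
open Summit.HubbardSuperconductivity.HubbardSuperconductivity.Theses.AnisotropyChord

/-- **The thermal chord implies `ChordXY`.** If for every even `M ≥ 4` and `Δ ∈ [-1, 0]` the canonical sector
condensate satisfies `(1+Δ)·Λ_{β,M}(0) ≤ Λ_{β,M}(Δ)` for all large `β` (the registered stub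
`stub_thermalChordAF`, verbatim), then the route decl `ChordXY` holds: by `stub_groundStateLimit` the two sides
converge to `(1+Δ)·Re⟨ψ₀, S⁺S⁻ψ₀⟩` and `Re⟨ψ, S⁺S⁻ψ⟩` for any normalised sector ground states `ψ₀` of `H_M(0)`
and `ψ` of `H_M(Δ)`, and the inequality passes to the limit. Bratteli–Robinson II §5.3.1. [folklore] -/
theorem chordXY_of_thermalChordAF
    (hT : ∀ (M : ℕ) [NeZero M], Even M → 4 ≤ M → ∀ Δ ∈ Set.Icc (-1:ℝ) 0,
      ∀ᶠ β : ℝ in atTop, (1 + Δ) * thermalCondensate M β 0 ≤ thermalCondensate M β Δ) :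
    ChordXY := by
  intro M _ hE h4 Δ hΔ ψ₀ ψ hmem₀ hψ₀1 heig₀ hmem hψ1 heig
  have h2 : 2 ≤ M := le_trans (by norm_num) h4
  have hlim₀ := (stub_groundStateLimit M hE h2 0 ψ₀ hmem₀ hψ₀1 heig₀).const_mul (1 + Δ)
  have hlim := stub_groundStateLimit M hE h2 Δ ψ hmem hψ1 heig
  exact le_of_tendsto_of_tendsto hlim₀ hlim (hT M hE h4 Δ hΔ)

end Summit.HubbardSuperconductivity.HubbardSuperconductivity.Theorems.AnisotropyChord

end
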